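import Summits.QuantumFields.BalabanUV.Beta.KernelWardRelative

/-!
# `BalabanUV.Beta.BlockFaceCount` — road «BF-x» junction (J1), the `Δ_n` words' contact families: **«FACE-COUNT» — THE PURE-GAUGE WEIGHT `gaugeWt N y κ′` OF A
# COARSE BLOCK HAS ℓ¹-NORM AT MOST `2·N^d` (THE `N^d` BONDS ENTERING THE BLOCK IN DIRECTION `κ′` AND THE `N^d` BONDS LEAVING IT)** — so a signed FACE SUM of raw
# tables over a block is a combination of at most `2(d+1)·N^d` tables with coefficients `±1`: ONE POWER OF `N` BELOW the `2(d+1)·N^{d+1}` sites of leaf-03's face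
# neighbourhood `bondNbhd` (UNCONDITIONAL; [folklore] finite combinatorics of the block decomposition)

HONEST DEPENDENCY (cell records, verbatim): «continuum YM on T⁴ ⇐ BetaPertH ∧ nine spine estimates (0/9 proved); BetaPertH ⇐ (D1) ∧ (D4) ∧
CAP+tail; G-an2-4 gates asym, D1 and NE2/3/4.»  HONEST FRAMING (cell contract, verbatim): «discharging `BetaPertH` makes Bałaban's UV stability
UNCONDITIONAL — a real constructive-QFT result; it is NOT the continuum limit and NOT the Clay problem.»  THIS MODULE DISCHARGES NOTHING of the
wall: [folklore] finset counting BY NAME over an1's `KernelWardRelative.gaugeWt` (`1_{B(y)}(u + e_κ′) − 1_{B(y)}(u)`) and the block decomposition of a site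
(`AveragingContours.blk_add_off ∕ off_mem_box ∕ blk_block`).  No definition, no `def … : Prop`, nothing cited, 0 sorry; nothing of Bałaban's (or an1's ∕ an3's)
tables asserted; NO (1.22) row; 0 root-level binders of row D1 discharged; (J1) = ONE OPEN ROW `hC₁ := Δ_n`; [W] OPEN; (K) NOT closed; NOT D1, NOT `BetaPertH`,
NOT continuum, NOT Clay.

ABSOLUTE RULE (cell charter, verbatim): «No internally-minted statement may enter as a cited fact. Every hypothesis is either kernel-proved in
this package or a verbatim quotation of a PUBLISHED theorem with page reference. The manuscript(s) under audit are NOT citable for their own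
disputed steps — they are the thing under adjudication; programme-internal (2001/route/tribunal) claims are never citable.»

WHY (my X2 on leaf-03 g29's TT3a `SymCorrectorFace`, GAPS § C-gan24leaf05-g58-2 INFO (i); the OWNER's `J1-DEFECT-WORDS` v0.1 (R-c2) «the surface family lives on block
faces (volume fraction ≍ 1∕n)»): leaf-03's face sum `faceSum n T Y = Σ_{κ′} Σ_{u ∈ bondNbhd n Y κ′} gaugeWt n Y κ′ u • T κ′ u` is indexed by the face NEIGHBOURHOOD
(`≤ 2n^{d+1}` sites per direction, `card_bondNbhd_le`), but its coefficients `gaugeWt ∈ {0, ±1}` vanish except on the bonds CROSSING `∂B(Y)`: the present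
count `Σ_{u ∈ Φ} |gaugeWt N y κ′ u| ≤ 2·N^d` (any finset `Φ`) is the letter that turns «FACE-PACK» §4's `e^{2σR}·Σ_s |a s|·ρ s` into
`e^{2σR}·2(d+1)·N^d·ρ` for a UNIFORM per-slot letter `ρ` on the crossing slots — i.e. the block-table mass `≤ n³·m̄F` of
`PackedColumnBlockIndexedMass.mass_blk_vertexOfK_G₀_le_of_blockIndexed_split` at `d = 3` with `m̄F := 2(d+1)·e^{2σR}·ρ`.  Mechanism: a bond `(κ′, u)` leaves the
block iff `u = N•y + b` with `b_{κ′} = N − 1`, enters it iff `u + e_κ′ = N•y + b′` with `b′_{κ′} = 0` (otherwise the shifted box point stays in the box and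
`blk_block` keeps the block index); each coordinate slice of the box has `N^d` points (`Fintype.card_piFinset` on the updated range family).

CONTENT (all [folklore]).  `card_box_filter_coord` (`#{b ∈ box (d+1) N : b κ = c} = N^d` for `c < N`), `toSite_update` (moving one box coordinate moves the site
along `e_κ`), `mem_leaving_of_gaugeWt` ∕ `mem_entering_of_gaugeWt` (support of the two indicators), `abs_gaugeWt_le_indicators`,
**`sum_abs_gaugeWt_le`**: `Σ_{u ∈ Φ} |gaugeWt N y κ′ u| ≤ 2·N^d` for every finset `Φ` of sites, every `N ≥ 1`, coarse site `y`, direction `κ′`; and summed over the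
directions **`sum_univ_sum_abs_gaugeWt_le`**: `Σ_{κ′} Σ_{u ∈ Φ κ′} |gaugeWt N y κ′ u| ≤ (d+1)·(2·N^d)`.
NOT HERE (honest): the face-sum mass corollary itself (three lines over «FACE-PACK» §4 once both oleans serve — staged separately); any per-slot letter; any (1.22) row.
Unit `b2b-balaban-gan24-formalise-leaf-05` (gen 58), G-an2-4 swarm leaf prover 05, road «BF-x» supplier; INTENT-3 «FACE-COUNT» (journal).
-/

open Finset
open scoped BigOperators
open Literature.MathematicalPhysics.QuantumFieldTheory
open Literature.MathematicalPhysics.QuantumFieldTheory.Balaban1983to89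
open Literature.MathematicalPhysics.QuantumFieldTheory.Balaban1983to89.Beta
open B6BondElimination (unitVec unitVec_apply)
open AffineAveraging (box toSite)
open AveragingContours (blk off off_mem_box blk_add_off blk_block)
open Summit.QuantumFields.BalabanUV.Beta.KernelWardRelative (gaugeWt)

namespace Summit.QuantumFields.BalabanUV.Beta.BlockFaceCount

variable {d : ℕ}

/-- [folklore] **A COORDINATE SLICE OF THE BOX HAS `N^d` POINTS**: `#{b ∈ box (d+1) N : b κ = c} = N^d` for `c < N`. -/
theorem card_box_filter_coord (N : ℕ) (κ : Fin (d + 1)) {c : ℕ} (hc : c < N) :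
    ((box (d + 1) N).filter fun b => b κ = c).card = N ^ d := by
  classical
  have e : (box (d + 1) N).filter (fun b => b κ = c)
      = Fintype.piFinset (Function.update (fun _ : Fin (d + 1) => Finset.range N) κ {c}) := by
    ext b
    simp only [AffineAveraging.box, Finset.mem_filter, Fintype.mem_piFinset, Finset.mem_range]
    constructor
    · rintro ⟨hb, hκ⟩ i
      by_cases hi : i = κ
      · subst hi; rw [Function.update_self, Finset.mem_singleton]; exact hκ
      · rw [Function.update_of_ne hi, Finset.mem_range]; exact hb i
    · intro h
      refine ⟨fun i => ?_, ?_⟩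
      · by_cases hi : i = κ
        · subst hi; have := h i; rw [Function.update_self, Finset.mem_singleton] at this; rw [this]; exact hc
        · have := h i; rwa [Function.update_of_ne hi, Finset.mem_range] at this
      · have := h κ; rwa [Function.update_self, Finset.mem_singleton] at this
  rw [e, Fintype.card_piFinset, ← Finset.prod_erase_mul _ _ (Finset.mem_univ κ), Function.update_self, Finset.card_singleton, mul_one,
    Finset.prod_congr rfl fun i hi => by rw [Function.update_of_ne (Finset.ne_of_mem_erase hi), Finset.card_range],
    Finset.prod_const, Finset.card_erase_of_mem (Finset.mem_univ κ), Finset.card_univ, Fintype.card_fin, Nat.add_sub_cancel]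

/-- [folklore] **MOVING ONE BOX COORDINATE MOVES THE SITE ALONG `e_κ`**: `toSite (update b κ m) = toSite b + (m − b κ)•e_κ` in the form used below:
`toSite (update b κ m) i = toSite b i + (if i = κ then (m : ℤ) - b κ else 0)`. -/
theorem toSite_update (b : Fin (d + 1) → ℕ) (κ : Fin (d + 1)) (m : ℕ) (i : Fin (d + 1)) :
    toSite (Function.update b κ m) i = toSite b i + (if i = κ then ((m : ℤ) - (b κ : ℤ)) else 0) := by
  by_cases hi : i = κ
  · subst hi; simp [toSite, Function.update_self]
  · simp [toSite, hi]

/-- [folklore] **A LEAVING BOND STARTS ON THE TOP SLICE**: if `blk N u = y` but `blk N (u + e_κ′) ≠ y` (`N ≥ 1`), then `u = N•y + toSite b` for a box point `b` with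
`b κ′ = N − 1` (were `b κ′ + 1 < N`, the shifted point would stay in the box and keep the block index, `blk_block`). -/
theorem mem_leaving_of_gaugeWt {N : ℕ} (hN : 1 ≤ N) (y : Fin (d + 1) → ℤ) (κ' : Fin (d + 1)) {u : Fin (d + 1) → ℤ}
    (h1 : blk N u = y) (h2 : blk N (u + unitVec κ') ≠ y) :
    u ∈ ((box (d + 1) N).filter fun b => b κ' = N - 1).image fun b => (N : ℤ) • y + toSite b := by
  classical
  have hu : (N : ℤ) • y + toSite (off N u) = u := by rw [← h1]; exact blk_add_off hN u
  have hb : off N u ∈ box (d + 1) N := off_mem_box hN u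
  refine Finset.mem_image.2 ⟨off N u, Finset.mem_filter.2 ⟨hb, ?_⟩, hu⟩
  have hlt : off N u κ' < N := Finset.mem_range.1 (Fintype.mem_piFinset.1 hb κ')
  by_contra hne
  have hlt' : off N u κ' + 1 < N := by omega
  -- the shifted point stays in the box
  set b' : Fin (d + 1) → ℕ := Function.update (off N u) κ' (off N u κ' + 1) with hb'
  have hb'box : b' ∈ box (d + 1) N := by
    refine Fintype.mem_piFinset.2 fun i => Finset.mem_range.2 ?_
    by_cases hi : i = κ'
    · subst hi; rw [hb', Function.update_self]; exact hlt'
    · rw [hb', Function.update_of_ne hi]; exact Finset.mem_range.1 (Fintype.mem_piFinset.1 hb i)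
  have e : u + unitVec κ' = (N : ℤ) • y + toSite b' := by
    funext i
    rw [Pi.add_apply, ← hu, Pi.add_apply, Pi.add_apply, hb', toSite_update, unitVec_apply]
    by_cases hi : i = κ'
    · simp [hi, add_assoc]
    · simp [hi]
  exact h2 (by rw [e]; exact blk_block y hb'box)

/-- [folklore] **AN ENTERING BOND ENDS ON THE BOTTOM SLICE**: if `blk N (u + e_κ′) = y` but `blk N u ≠ y` (`N ≥ 1`), then `u = N•y + toSite b′ − e_κ′` for a box
point `b′` with `b′ κ′ = 0`. -/
theorem mem_entering_of_gaugeWt {N : ℕ} (hN : 1 ≤ N) (y : Fin (d + 1) → ℤ) (κ' : Fin (d + 1)) {u : Fin (d + 1) → ℤ}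
    (h1 : blk N (u + unitVec κ') = y) (h2 : blk N u ≠ y) :
    u ∈ ((box (d + 1) N).filter fun b => b κ' = 0).image fun b => (N : ℤ) • y + toSite b - unitVec κ' := by
  classical
  have hu : (N : ℤ) • y + toSite (off N (u + unitVec κ')) = u + unitVec κ' := by rw [← h1]; exact blk_add_off hN _
  have hb : off N (u + unitVec κ') ∈ box (d + 1) N := off_mem_box hN _
  refine Finset.mem_image.2 ⟨off N (u + unitVec κ'), Finset.mem_filter.2 ⟨hb, ?_⟩, by rw [hu, add_sub_cancel_right]⟩
  by_contra hne
  have hpos : 1 ≤ off N (u + unitVec κ') κ' := Nat.one_le_iff_ne_zero.2 hne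
  have hlt : off N (u + unitVec κ') κ' < N := Finset.mem_range.1 (Fintype.mem_piFinset.1 hb κ')
  -- the back-shifted point stays in the box
  set b' : Fin (d + 1) → ℕ := Function.update (off N (u + unitVec κ')) κ' (off N (u + unitVec κ') κ' - 1) with hb'
  have hb'box : b' ∈ box (d + 1) N := by
    refine Fintype.mem_piFinset.2 fun i => Finset.mem_range.2 ?_
    by_cases hi : i = κ'
    · subst hi; rw [hb', Function.update_self]; omega
    · rw [hb', Function.update_of_ne hi]; exact Finset.mem_range.1 (Fintype.mem_piFinset.1 hb i)
  have e : u = (N : ℤ) • y + toSite b' := by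
    funext i
    have hui : u i = ((N : ℤ) • y + toSite (off N (u + unitVec κ'))) i - unitVec κ' i := by
      rw [hu, Pi.add_apply]; ring
    rw [hui, Pi.add_apply, Pi.add_apply, hb', toSite_update, unitVec_apply]
    by_cases hi : i = κ'
    · subst hi; simp; push_cast [Nat.cast_sub hpos]; ring
    · simp [hi]
  exact h2 (by rw [e]; exact blk_block y hb'box)

/-- [folklore] **THE PURE-GAUGE WEIGHT IS DOMINATED BY THE TWO SLICE INDICATORS**: `|gaugeWt N y κ′ u| ≤ [u leaving] + [u entering]`. -/
theorem abs_gaugeWt_le_indicators {N : ℕ} (hN : 1 ≤ N) (y : Fin (d + 1) → ℤ) (κ' : Fin (d + 1)) (u : Fin (d + 1) → ℤ) :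
    |gaugeWt N y κ' u|
      ≤ (if u ∈ ((box (d + 1) N).filter fun b => b κ' = N - 1).image (fun b => (N : ℤ) • y + toSite b) then (1 : ℝ) else 0)
        + (if u ∈ ((box (d + 1) N).filter fun b => b κ' = 0).image (fun b => (N : ℤ) • y + toSite b - unitVec κ') then (1 : ℝ) else 0) := by
  classical
  rw [gaugeWt]
  by_cases h1 : blk N u = y <;> by_cases h2 : blk N (u + unitVec κ') = y
  · rw [if_pos h2, if_pos h1, sub_self, abs_zero]; positivity
  · rw [if_neg h2, if_pos h1, if_pos (mem_leaving_of_gaugeWt hN y κ' h1 h2)]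
    norm_num; positivity
  · rw [if_pos h2, if_neg h1]
    have := mem_entering_of_gaugeWt hN y κ' h2 h1
    rw [if_pos this]; norm_num; positivity
  · rw [if_neg h2, if_neg h1, sub_self, abs_zero]; positivity

/-- [folklore] **«FACE-COUNT»: THE PURE-GAUGE WEIGHT OF A BLOCK HAS ℓ¹-NORM AT MOST `2·N^d`** — for every finset `Φ` of sites, every `N ≥ 1`, coarse site `y` and
direction `κ′`: `Σ_{u ∈ Φ} |gaugeWt N y κ′ u| ≤ 2·N^d` (`N^d` leaving bonds on the top slice `b κ′ = N−1`, `N^d` entering bonds below the bottom slice `b′ κ′ = 0`). -/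
theorem sum_abs_gaugeWt_le {N : ℕ} (hN : 1 ≤ N) (y : Fin (d + 1) → ℤ) (κ' : Fin (d + 1)) (Φ : Finset (Fin (d + 1) → ℤ)) :
    ∑ u ∈ Φ, |gaugeWt N y κ' u| ≤ 2 * (N : ℝ) ^ d := by
  classical
  set L : Finset (Fin (d + 1) → ℤ) := ((box (d + 1) N).filter fun b => b κ' = N - 1).image fun b => (N : ℤ) • y + toSite b with hL
  set E : Finset (Fin (d + 1) → ℤ) := ((box (d + 1) N).filter fun b => b κ' = 0).image fun b => (N : ℤ) • y + toSite b - unitVec κ' with hE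
  have hLc : (L.card : ℝ) ≤ (N : ℝ) ^ d := by
    have h : L.card ≤ N ^ d := Finset.card_image_le.trans (card_box_filter_coord N κ' (by omega)).le
    exact_mod_cast h
  have hEc : (E.card : ℝ) ≤ (N : ℝ) ^ d := by
    have h : E.card ≤ N ^ d := Finset.card_image_le.trans (card_box_filter_coord N κ' (by omega)).le
    exact_mod_cast h
  have hind : ∀ S : Finset (Fin (d + 1) → ℤ), ∑ u ∈ Φ, (if u ∈ S then (1 : ℝ) else 0) ≤ S.card := by
    intro S
    rw [Finset.sum_boole]
    exact_mod_cast Finset.card_le_card (fun u hu => (Finset.mem_filter.1 hu).2)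
  calc ∑ u ∈ Φ, |gaugeWt N y κ' u|
      ≤ ∑ u ∈ Φ, ((if u ∈ L then (1 : ℝ) else 0) + (if u ∈ E then (1 : ℝ) else 0)) :=
        Finset.sum_le_sum fun u _ => abs_gaugeWt_le_indicators hN y κ' u
    _ = ∑ u ∈ Φ, (if u ∈ L then (1 : ℝ) else 0) + ∑ u ∈ Φ, (if u ∈ E then (1 : ℝ) else 0) := Finset.sum_add_distrib
    _ ≤ L.card + E.card := add_le_add (hind L) (hind E)
    _ ≤ (N : ℝ) ^ d + (N : ℝ) ^ d := add_le_add hLc hEc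
    _ = 2 * (N : ℝ) ^ d := by ring

/-- [folklore] **… SUMMED OVER THE DIRECTIONS**: `Σ_{κ′} Σ_{u ∈ Φ κ′} |gaugeWt N y κ′ u| ≤ (d+1)·(2·N^d)` (the number of bonds crossing `∂B(y)`). -/
theorem sum_univ_sum_abs_gaugeWt_le {N : ℕ} (hN : 1 ≤ N) (y : Fin (d + 1) → ℤ) (Φ : Fin (d + 1) → Finset (Fin (d + 1) → ℤ)) :
    ∑ κ' : Fin (d + 1), ∑ u ∈ Φ κ', |gaugeWt N y κ' u| ≤ ((d : ℝ) + 1) * (2 * (N : ℝ) ^ d) := by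
  calc ∑ κ' : Fin (d + 1), ∑ u ∈ Φ κ', |gaugeWt N y κ' u| ≤ ∑ _κ' : Fin (d + 1), 2 * (N : ℝ) ^ d :=
        Finset.sum_le_sum fun κ' _ => sum_abs_gaugeWt_le hN y κ' (Φ κ')
    _ = ((d : ℝ) + 1) * (2 * (N : ℝ) ^ d) := by
        rw [Finset.sum_const, Finset.card_univ, Fintype.card_fin, nsmul_eq_mul]; push_cast; ring

end Summit.QuantumFields.BalabanUV.Beta.BlockFaceCount
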